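import Summits.ResolutionOfSingularities.ResolutionOfSingularities.Theorems.DecompositionDescentLU5
import HarnessLib

/-!
# DecompositionDescentLU (6/7) — layer 2, engine frame: quasi-finite regular model upstairs = normalized base change (ZMT)

Part 6 of the g27 node `DecompositionDescentLU` of the ROOT/RESIDUAL decomposition cell `decomp-res`
(lens 1, window (W-dec) of critic rows 178/193/202); see the module docstring of
`Summits.ResolutionOfSingularities.ResolutionOfSingularities.Theorems.DecompositionDescentLU` (part 1/7)
for the thesis, the three layers of [CossartPiltant2008, Prop. 9.3], the two currencies of the decomposition
cell (structure: `DecompositionFieldLUAbove`; witnesses: `DecWitnessLUAbove`), the laws, the residual R27, the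
cut and the sources.  Problem side, sorry-free, hypothesis-free.

This part: `exists_div_of_mem_closure`, `isIntegral_of_subring_le` and the layer-2 engine
`exists_normalization_regular_of_quasiFinite` ([CossartPiltant2008, (52)] + Zariski's Main Theorem).
-/

noncomputable section

open IsLocalRing IntermediateField Polynomial Literature.AlgebraicGeometry.Resolution
open scoped Pointwise

namespace Summit.ResolutionOfSingularities.ResolutionOfSingularities.Theorems.DecompositionDescentLU

universe u

/-! ## PART D — layer 2 (engine frame): a QUASI-FINITE regular model upstairs IS the normalized base change
([CossartPiltant2008, (52)] + Zariski's Main Theorem), hence layer 1 applies -/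

section Engine2

variable {E : Type u} [Field E] (OE : ValuationSubring E) {M : Subfield E}

/-- **ENGINE OF LAYER 2 — "by (52) and Zariski's Main Theorem, `R` lies below `S′`", hypothesis-free.**
Frame: `k ⊆ M ⊆ K′ ⊆ M(η) ⊆ E`, `η` a Hensel root over `O_E ∩ M` (so `K′ | M` is finite separable),
residues of `O_E` algebraic over `k`.  Data: a finite set `s ⊆ M ∩ O_E` generating `M` over `k` (the
model to dominate) and an UPSTAIRS model `k[t] ⊆ O_E` of `K′` (`t ⊆ K′`, `Frac k[t] = K′`) containing `s`,
REGULAR at the centre of `O_E`, whose closed point is RADICALLY CUT OUT BY FINITELY MANY `M`-RATIONAL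
FUNCTIONS `F ⊆ k[t] ∩ 𝔪` ([CossartPiltant2008, (52)]: every `y ∈ k[t]` of positive value has
`b·yⁿ ∈ F·k[t]` for some `b ∈ k[t]` of value `0`).  Conclusion: the normal model `k[t₁] ⊇ k[s ∪ F]` of
`M` (finiteness of normalization, tree `exists_adjoin_isIntegrallyClosedIn`) has integral closure
`k[t₁ ∪ t₁′]` in `K′` (tree `exists_adjoin_eq_integralClosure_extension`) whose local ring at the centre
IS `S′ = k[t]_{𝔪}` (tree `locAtCentre_le_locAtCentre_of_forall_isPrime` = Zariski's Main Theorem, birational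
local form), hence is regular: exactly the datum the layer-1 cell `DecompositionFieldLUAbove` asks for.
No port, no named fact. (Sources: CossartPiltant2008, proof of Prop. 9.3, (52) and last paragraph (HAL p. 28);
StacksProject, Tag 00Q9.) -/
theorem exists_normalization_regular_of_quasiFinite (k : Type u) [Field k] [Algebra k E]
    (hkM : ∀ c : k, algebraMap k E c ∈ M) (hkO : ∀ c : k, algebraMap k E c ∈ OE)
    {η : E} {f : E[X]} (hfM : ∀ i, f.coeff i ∈ M) (hfη : f.eval η = 0)
    (hder : OE.valuation ((derivative f).eval η) = 1)
    (K' : Subfield E) (hMK' : M ≤ K') (hK'cl : K' ≤ Subfield.closure ((M : Set E) ∪ {η}))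
    (hres : ∀ y ∈ OE, ∃ g : k[X], g ≠ 0 ∧ OE.valuation (Polynomial.aeval y g) < 1)
    (s : Finset E) (hsM : (s : Set E) ⊆ M)
    (hMs : M ≤ Subfield.closure (Set.range (algebraMap k E) ∪ (s : Set E)))
    (t : Finset E) (htK' : (t : Set E) ⊆ K') (hst : (s : Set E) ⊆ Algebra.adjoin k (t : Set E))
    (htO : (Algebra.adjoin k (t : Set E)).toSubring ≤ OE.toSubring)
    (hK't : K' ≤ Subfield.closure (Set.range (algebraMap k E) ∪ (t : Set E)))
    (hreg : IsRegularLocalRing (locAtCentre (Algebra.adjoin k (t : Set E)).toSubring OE))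
    (F : Finset E) (hFM : (F : Set E) ⊆ M) (hFt : (F : Set E) ⊆ Algebra.adjoin k (t : Set E))
    (hFv : ∀ x ∈ F, OE.valuation x < 1)
    (hrad : ∀ y ∈ Algebra.adjoin k (t : Set E), OE.valuation y < 1 →
      ∃ n : ℕ, ∃ b ∈ Algebra.adjoin k (t : Set E), OE.valuation b = 1 ∧
        b * y ^ n ∈ Submodule.span (Algebra.adjoin k (t : Set E)) (F : Set E)) :
    ∃ t₁ : Finset E, (t₁ : Set E) ⊆ M ∧ (s : Set E) ⊆ Algebra.adjoin k (t₁ : Set E) ∧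
      (Algebra.adjoin k (t₁ : Set E)).toSubring ≤ OE.toSubring ∧
      (∀ x ∈ M, IsIntegral (Algebra.adjoin k (t₁ : Set E)) x → x ∈ Algebra.adjoin k (t₁ : Set E)) ∧
      ∃ t₁' : Finset E, (t₁' : Set E) ⊆ K' ∧
        (∀ x ∈ K', IsIntegral (Algebra.adjoin k (t₁ : Set E)) x ↔
          x ∈ Algebra.adjoin k ((t₁ : Set E) ∪ (t₁' : Set E))) ∧
        ∃ _ : (Algebra.adjoin k ((t₁ : Set E) ∪ (t₁' : Set E))).toSubring ≤ OE.toSubring,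
          IsRegularLocalRing (locAtCentre (Algebra.adjoin k ((t₁ : Set E) ∪ (t₁' : Set E))).toSubring OE) := by
  classical
  haveI : IsAdicComplete (maximalIdeal k) k := by
    rw [(isField_iff_maximalIdeal_eq).mp (Field.toIsField k)]; infer_instance
  have hkK' : ∀ c : k, algebraMap k E c ∈ K' := fun c => hMK' (hkM c)
  -- (a) the normal model `k[t₁] ⊇ k[s ∪ F]` of `M`
  set t₀ : Finset E := s ∪ F with ht₀def
  have ht₀M : (t₀ : Set E) ⊆ M := by
    rw [ht₀def, Finset.coe_union]; exact Set.union_subset hsM hFM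
  have hMt₀ : M ≤ Subfield.closure (Set.range (algebraMap k E) ∪ (t₀ : Set E)) :=
    hMs.trans (Subfield.closure_mono (Set.union_subset_union_right _
      (by rw [ht₀def, Finset.coe_union]; exact Set.subset_union_left)))
  obtain ⟨t₁, ht₀t₁, ht₁M, ht₁int, hnorm⟩ := exists_adjoin_isIntegrallyClosedIn k E M hkM t₀ ht₀M hMt₀
  set B₀ : Subalgebra k E := Algebra.adjoin k (t₁ : Set E) with hB₀def
  have ht₀t : Algebra.adjoin k (t₀ : Set E) ≤ Algebra.adjoin k (t : Set E) :=
    Algebra.adjoin_le (by rw [ht₀def, Finset.coe_union]; exact Set.union_subset hst hFt)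
  have ht₀O : (Algebra.adjoin k (t₀ : Set E)).toSubring ≤ OE.toSubring := fun x hx => htO (ht₀t hx)
  have hB₀O : B₀.toSubring ≤ OE.toSubring :=
    model_toSubring_le_valuationSubring_of_isIntegral OE hkO (t₀ : Set E) ht₀O
      (fun x hx => ht₁int x (Finset.mem_coe.mp hx))
  have hMt₁ : M ≤ Subfield.closure (Set.range (algebraMap k E) ∪ (t₁ : Set E)) :=
    hMt₀.trans (Subfield.closure_mono (Set.union_subset_union_right _ ht₀t₁))
  -- (b) `K′` as a finite separable extension of `M`
  have hint : IsIntegral M η := isIntegral_of_henselRoot OE hfM hfη hder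
  have hsep : IsSeparable M η := isSeparable_of_henselRoot OE hfM hfη hder
  let K'M : IntermediateField M E := K'.toIntermediateField (fun x => hMK' x.2)
  have hmemK'M : ∀ y : E, y ∈ K'M ↔ y ∈ K' := fun _ => Iff.rfl
  have hrange : Set.range (algebraMap M E) = (M : Set E) := by
    ext z; constructor
    · rintro ⟨w, rfl⟩; exact w.2
    · intro hz; exact ⟨⟨z, hz⟩, rfl⟩
  have hK'Mle : K'M ≤ M⟮η⟯ := fun y hy => by
    have h1 : y ∈ Subfield.closure ((M : Set E) ∪ {η}) := hK'cl ((hmemK'M y).mp hy)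
    rw [← IntermediateField.mem_toSubfield, IntermediateField.adjoin_toSubfield, hrange]
    exact h1
  haveI : FiniteDimensional M M⟮η⟯ := IntermediateField.adjoin.finiteDimensional hint
  haveI : FiniteDimensional M K'M :=
    Module.Finite.of_injective (IntermediateField.inclusion hK'Mle).toLinearMap
      (IntermediateField.inclusion_injective hK'Mle)
  haveI : Algebra.IsSeparable M M⟮η⟯ :=
    (IntermediateField.isSeparable_adjoin_simple_iff_isSeparable M E).mpr hsep
  haveI : Algebra.IsSeparable M K'M :=
    Algebra.IsSeparable.of_algHom M _ (IntermediateField.inclusion hK'Mle)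
  -- (c) the integral closure `B = k[t₁ ∪ t₁′]` of `k[t₁]` in `K′`
  obtain ⟨t₁', ht₁'K', hBint, hext⟩ :=
    exists_adjoin_eq_integralClosure_extension k E M hkM K'M t₁ ht₁M hMt₁ hnorm
  set B : Subalgebra k E := Algebra.adjoin k ((t₁ : Set E) ∪ (t₁' : Set E)) with hBdef
  have hB₀B : B₀ ≤ B := Algebra.adjoin_mono Set.subset_union_left
  -- (d) the upstairs local ring `S′` contains `B`
  set S' : Subring E := locAtCentre (Algebra.adjoin k (t : Set E)).toSubring OE with hS'def
  have htK'sub : (Algebra.adjoin k (t : Set E)).toSubring ≤ K'.toSubring :=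
    model_toSubring_le_of_subset hkK' htK'
  have hK'frac : ∀ z ∈ K', ∃ a ∈ (Algebra.adjoin k (t : Set E)).toSubring,
      ∃ b ∈ (Algebra.adjoin k (t : Set E)).toSubring, b ≠ 0 ∧ z = a / b :=
    fun z hz => exists_div_of_mem_closure (t : Set E) (hK't hz)
  have hS'cl : ∀ x ∈ K', IsIntegral S' x → x ∈ S' := fun x hx hxi =>
    mem_locAtCentre_of_isIntegral (Algebra.adjoin k (t : Set E)) OE hreg K' htK'sub hK'frac hx hxi
  have htS' : (Algebra.adjoin k (t : Set E)).toSubring ≤ S' := le_locAtCentre _ OE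
  have hkS' : ∀ c : k, algebraMap k E c ∈ S' := fun c => htS' (Subalgebra.algebraMap_mem _ c)
  have ht₁S' : ∀ x ∈ (t₁ : Set E), x ∈ S' := fun x hx =>
    hS'cl x (hMK' (ht₁M hx))
      (isIntegral_of_subring_le (show (Algebra.adjoin k (t₀ : Set E)).toSubring ≤ S' from
        fun y hy => htS' (ht₀t hy)) (ht₁int x (Finset.mem_coe.mp hx)))
  have hB₀S' : B₀.toSubring ≤ S' := model_toSubring_le_of_subset hkS' ht₁S'
  have ht₁'S' : ∀ x ∈ (t₁' : Set E), x ∈ S' := fun x hx =>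
    hS'cl x ((hmemK'M x).mp (ht₁'K' hx))
      (isIntegral_of_subring_le hB₀S' (hBint x (Algebra.subset_adjoin (Or.inr hx))))
  have hBS' : B.toSubring ≤ S' :=
    model_toSubring_le_of_subset hkS' (Set.union_subset ht₁S' ht₁'S')
  have hS'O : S' ≤ OE.toSubring := locAtCentre_le htO
  have hBO : B.toSubring ≤ OE.toSubring := hBS'.trans hS'O
  -- (e) `Frac B = K′`
  have hB₀M : ∀ b : B₀, (b : E) ∈ M := fun b =>
    (model_toSubring_le_of_subset (C := M.toSubring) hkM ht₁M : B₀.toSubring ≤ M.toSubring) b.2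
  letI algB₀M : Algebra B₀ M := ((B₀.val : B₀ →+* E).codRestrict M hB₀M).toAlgebra
  letI algB₀K : Algebra B₀ K'M :=
    ((B₀.val : B₀ →+* E).codRestrict K'M (fun b => (hmemK'M _).mpr (hMK' (hB₀M b)))).toAlgebra
  haveI : IsScalarTower B₀ M K'M := IsScalarTower.of_algebraMap_eq fun _ => rfl
  haveI : IsScalarTower B₀ K'M E := IsScalarTower.of_algebraMap_eq fun _ => rfl
  haveI : FaithfulSMul B₀ M := (faithfulSMul_iff_algebraMap_injective B₀ M).mpr
    (fun a b hab => Subtype.ext (by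
      have := congrArg (fun w : M => (w : E)) hab
      exact this))
  haveI : IsFractionRing B₀ M := by
    refine IsFractionRing.of_field B₀ M fun z => ?_
    obtain ⟨a, ha, b, hb, -, hz⟩ := exists_div_of_mem_closure (t₁ : Set E) (hMt₁ z.2)
    exact ⟨⟨a, ha⟩, ⟨b, hb⟩, Subtype.ext hz⟩
  haveI : IsFractionRing (integralClosure B₀ K'M) K'M :=
    integralClosure.isFractionRing_of_finite_extension M K'M
  have hKB : ∀ z ∈ K', ∃ a ∈ B.toSubring, ∃ b ∈ B.toSubring, b ≠ 0 ∧ z = a / b := by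
    intro z hz
    obtain ⟨a, b, hb, hab⟩ :=
      IsFractionRing.div_surjective (A := integralClosure B₀ K'M) (⟨z, (hmemK'M z).mpr hz⟩ : K'M)
    have ha' : ((a : K'M) : E) ∈ B :=
      hext _ (a : K'M).2 ((a.2 : IsIntegral B₀ (a : K'M)).map (IsScalarTower.toAlgHom B₀ K'M E))
    have hb' : ((b : K'M) : E) ∈ B :=
      hext _ (b : K'M).2 ((b.2 : IsIntegral B₀ (b : K'M)).map (IsScalarTower.toAlgHom B₀ K'M E))
    have hb0 : ((b : K'M) : E) ≠ 0 := by
      intro h0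
      apply nonZeroDivisors.ne_zero hb
      exact Subtype.ext (Subtype.ext h0)
    refine ⟨_, ha', _, hb', hb0, ?_⟩
    have := congrArg (fun w : K'M => (w : E)) hab
    simpa using this.symm
  -- (f) `B` is integrally closed in `K′`
  letI algB₀B : Algebra B₀ B := (Subalgebra.inclusion hB₀B).toAlgebra
  haveI : IsScalarTower B₀ B E := IsScalarTower.of_algebraMap_eq fun _ => rfl
  haveI : Algebra.IsIntegral B₀ B := ⟨fun b =>
    (isIntegral_algHom_iff (IsScalarTower.toAlgHom B₀ B E) Subtype.val_injective).mp (hBint b b.2)⟩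
  have hnormB : ∀ x ∈ K', IsIntegral B x → x ∈ B := fun x hx hxi =>
    hext x ((hmemK'M x).mpr hx) (isIntegral_trans (R := B₀) x hxi)
  -- (g) the radical condition (52) read on the primes of `S′`
  haveI hS'loc : IsLocalRing S' := isLocalRing_locAtCentre htO
  have hradP : ∀ P : Ideal S', P.IsPrime →
      (∀ y : S', (y : E) ∈ locAtCentre B.toSubring OE → OE.valuation (y : E) < 1 → y ∈ P) →
      P = maximalIdeal S' := by
    intro P hP hPN
    refine le_antisymm (IsLocalRing.le_maximalIdeal hP.ne_top) fun y hy => ?_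
    have hvy : OE.valuation (y : E) < 1 := (mem_maximalIdeal_locAtCentre_iff htO y).mp hy
    obtain ⟨a, ha, z, hz, hvz, hyaz⟩ := y.2
    have hva : OE.valuation a < 1 := by
      have : OE.valuation (y : E) = OE.valuation a := by rw [hyaz, map_div₀, hvz, div_one]
      rwa [this] at hvy
    obtain ⟨n, b, hb, hvb, hspan⟩ := hrad a ha hva
    -- `F ⊆ P`
    have hFP : ∀ x ∈ (F : Set E), ∃ hx : x ∈ S', (⟨x, hx⟩ : S') ∈ P := fun x hx =>
      ⟨htS' (hFt hx), hPN _ (le_locAtCentre _ OE (hB₀B (ht₀t₁.trans Algebra.subset_adjoin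
        (by rw [ht₀def, Finset.coe_union]; exact Or.inr hx)) |> fun h => h))
        (hFv x (Finset.mem_coe.mp hx))⟩
    -- `F·k[t] ⊆ P`
    have hspanP : ∀ w ∈ Submodule.span (Algebra.adjoin k (t : Set E)) (F : Set E),
        ∃ hw : w ∈ S', (⟨w, hw⟩ : S') ∈ P := by
      intro w hw
      refine Submodule.span_induction (p := fun w _ => ∃ hw : w ∈ S', (⟨w, hw⟩ : S') ∈ P)
        (fun x hx => hFP x hx) ⟨S'.zero_mem, P.zero_mem⟩ ?_ ?_ hw
      · rintro x y - - ⟨hx, hxP⟩ ⟨hy, hyP⟩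
        exact ⟨S'.add_mem hx hy, P.add_mem hxP hyP⟩
      · rintro r x - ⟨hx, hxP⟩
        have hrx : r • x = (r : E) * x := by rw [Subalgebra.smul_def, smul_eq_mul]
        have hmem : (r : E) * x ∈ S' := S'.mul_mem (htS' r.2) hx
        refine ⟨hrx ▸ hmem, ?_⟩
        have : (⟨r • x, hrx ▸ hmem⟩ : S') = ⟨(r : E), htS' r.2⟩ * ⟨x, hx⟩ := Subtype.ext hrx
        rw [this]; exact P.mul_mem_left _ hxP
    obtain ⟨hban, hbanP⟩ := hspanP _ hspan
    have hbS' : b ∈ S' := htS' hb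
    have haS' : a ∈ S' := htS' ha
    have hsplit : (⟨b * a ^ n, hban⟩ : S') = ⟨b, hbS'⟩ * ⟨a, haS'⟩ ^ n := Subtype.ext rfl
    rw [hsplit] at hbanP
    have hbu : IsUnit (⟨b, hbS'⟩ : S') := by
      by_contra hnu
      have := (not_isUnit_locAtCentre_iff htO _).mp hnu
      change OE.valuation b < 1 at this
      rw [hvb] at this; exact lt_irrefl _ this
    have haP : (⟨a, haS'⟩ : S') ∈ P := by
      rcases hP.mem_or_mem hbanP with hbP | hanP
      · exact absurd (Ideal.eq_top_of_isUnit_mem P hbP hbu) hP.ne_top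
      · exact hP.mem_of_pow_mem n hanP
    have hzinv : z⁻¹ ∈ S' := inv_mem_locAtCentre (htS' hz) hvz
    have hyeq : y = ⟨a, haS'⟩ * ⟨z⁻¹, hzinv⟩ := Subtype.ext (by
      change (y : E) = a * z⁻¹; rw [hyaz, div_eq_mul_inv])
    rw [hyeq]; exact P.mul_mem_right _ haP
  -- (h) residues of `O_E` are algebraic over `k`, in the frame's form
  have hres' : ∀ y : OE, ∃ q : k[X], (∃ i, q.coeff i ∉ maximalIdeal k) ∧
      OE.valuation (q.eval₂ (algebraMap k E) (y : E)) < 1 := by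
    intro y
    obtain ⟨g, hg0, hgv⟩ := hres y y.2
    obtain ⟨i, hi⟩ : ∃ i, g.coeff i ≠ 0 := by
      by_contra hall; push Not at hall
      exact hg0 (Polynomial.ext fun i => by rw [hall i, Polynomial.coeff_zero])
    refine ⟨g, ⟨i, ?_⟩, ?_⟩
    · rw [(isField_iff_maximalIdeal_eq).mp (Field.toIsField k), Ideal.mem_bot]; exact hi
    · rw [← Polynomial.aeval_def]; exact hgv
  -- (i) Zariski's Main Theorem: `S′ = N := B_{𝔪 ∩ B}`
  have hle : S' ≤ locAtCentre B.toSubring OE :=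
    locAtCentre_le_locAtCentre_of_forall_isPrime OE hkO hres' B hBO t htO hBS' K' hkK' htK' hKB hnormB hradP
  have hge : locAtCentre B.toSubring OE ≤ S' := by
    have h := locAtCentre_mono OE hBS'
    rw [hS'def, locAtCentre_locAtCentre] at h
    rw [hS'def]; exact h
  have hSN : S' = locAtCentre B.toSubring OE := le_antisymm hle hge
  refine ⟨t₁, ht₁M, ht₀t₁.trans' (by rw [ht₀def, Finset.coe_union]; exact Set.subset_union_left)
    |>.trans Algebra.subset_adjoin, hB₀O, hnorm, t₁', fun x hx => (hmemK'M x).mp (ht₁'K' hx),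
    fun x hx => ⟨fun hxi => hext x ((hmemK'M x).mpr hx) hxi, fun hxB => hBint x hxB⟩, hBO, ?_⟩
  have hreg' : IsRegularLocalRing S' := hreg
  rw [hSN] at hreg'
  exact hreg'

end Engine2

end Summit.ResolutionOfSingularities.ResolutionOfSingularities.Theorems.DecompositionDescentLU

end
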